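import Literature.Probability.LatticeModels.LayeredPlaneRotatorStackStiffnessTransition
import Literature.Probability.LatticeModels.PlaneRotatorTorusBondSymmetry
import HarnessLib

/-!
# In-plane isotropy of the stack stiffness: the twist modulus is invariant under coupling-preserving
# automorphisms of the bond system; `βΥ_{L,σ i}(K) = βΥ_{L,i}(K)` for every permutation `σ` of the lattice
# directions with `K ∘ σ = K`; `βΥ^{3D}_{L,e₂}(K∥, K∥, K⊥) = βΥ^{3D}_{L,e₁}(K∥, K∥, K⊥)` at every `L`

Topic `Literature/Probability/LatticeModels`. Companion of `PlaneRotatorTorusBondSymmetry.lean` (p1's bond-energy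
invariance under automorphisms of a bond system), `LayeredPlaneRotatorStackStiffness.lean` (p588380: the directional
helicity modulus `torusXYDirStiffness L K i`) and `LayeredPlaneRotatorStackStiffnessTransition.lean` (p590350:
`Υ^{3D}_∞`, `K_Υ^{3D}(Δ, i)`). Everything is PROVED; no definition, no named fact, no numerics.

## Contents

* §1 **Transport under a coupling-preserving automorphism** `(e, ê)` of a finite bond system (`e : V ≃ V` on the
  sites, `ê : ι ≃ ι` on the bonds, `src ∘ ê = e ∘ src`, `tgt ∘ ê = e ∘ tgt`, `J ∘ ê = J`): every Gibbs expectation is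
  invariant under the relabelling `θ ↦ θ ∘ e` (`BondSystem.expectJ_comp_automorphism`: the Haar product measure is
  preserved, Mathlib `measurePreserving_piCongrLeft`, and so is the weight, `ginibreWeight_comp_equiv`); the twist
  current transforms as `𝒥_{J,s}(θ ∘ e) = 𝒥_{J, s ∘ ê⁻¹}(θ)` (`twistCurrent_comp_automorphism`); hence **the twist
  modulus is invariant: `Q_J(s ∘ ê⁻¹) = Q_J(s)`** (`BondSystem.twistModulus_automorphism`).
* §2 **Permuting the lattice directions of the torus.** For a permutation `σ` of `Fin d` the maps `x ↦ x ∘ σ` (sites)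
  and `(x, j) ↦ (x ∘ σ, σ⁻¹ j)` (bonds) form an automorphism of `torusXY d L`; if the direction-dependent couplings
  satisfy `K ∘ σ = K` it preserves them and carries the uniform `e_i`-twist to the uniform `e_{σ⁻¹ i}`-twist, so
  **`torusXYDirStiffness L K (σ i) = torusXYDirStiffness L K i`** (`torusXYDirStiffness_perm`); at constant coupling
  all `d` directional moduli coincide (`torusXYDirStiffness_const_eq`; on `(ℤ/Lℤ)²` both equal `torusXYStiffness L K`).
* §3 **The layered rotator on `(ℤ/Lℤ)³`** (`layeredCoupling K∥ K⊥ = (K∥, K∥, K⊥)`, invariant under the swap of the two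
  in-plane directions): `βΥ^{3D}_{L,e₂} = βΥ^{3D}_{L,e₁}` at every `L`, `K∥`, `K⊥`
  (`torusXYDirStiffness_layered_one_eq_zero`), hence `Υ^{3D}_∞(K∥, K⊥, e₂) = Υ^{3D}_∞(K∥, K⊥, e₁)` and
  `K_Υ^{3D}(Δ, e₂) = K_Υ^{3D}(Δ, e₁)`: the stack's in-plane stiffness, its lower envelope and its transition coupling
  are direction-free at every interlayer coupling.

Cell `pub/hubbard-tc` (MO-S3; G2 2D→3D ordering lemma in stiffness currency — «in-plane» is one number), classical
layered comparison model only, number-neutral. WHAT THIS IS NOT: no comparison of the in-plane with the c-axis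
modulus (`e₃` is not related to `e₁` by any automorphism of the layered couplings unless `K⊥ = K∥`), no statement at
`J⊥ > 0` beyond symmetry; never a Hubbard-model or material statement.

## References

* M. E. Fisher, M. N. Barber, D. Jasnow, Phys. Rev. A 8 (1973) 1111, §II eqs. (2.3)–(2.5) (helicity modulus of a
  twist direction). [FisherBarberJasnow1973]
* S. Friedli, Y. Velenik, *Statistical Mechanics of Lattice Systems*, CUP 2017, §3.1 (symmetries of the torus:
  translations, lattice rotations and reflections). [FriedliVelenik2017]
* J. Ginibre, Comm. Math. Phys. 16 (1970) 310, Example 4 (plane rotators). [Ginibre1970]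
* L. L. Liu, H. E. Stanley, Phys. Rev. Lett. 29 (1972) 927, p. 272 (layers `(J, J, εJ)`). [LiuStanley1972]

Tree: `BondSystem.bondChar_comp_equiv`, `ginibreWeight_comp_equiv`, `ginibreExpect_reChar_bondChar_eq_of_automorphism`,
`expectJ(_eq)`, `weightJ`, `twistCurrent`, `twistModulus`, `expectJ_twistCurrent_eq_zero`, `axisProfile`,
`torusXYDirStiffness(_two)`, `AnisotropicRotator.layeredCoupling`, `layeredStiffnessLiminf`,
`layeredStiffnessCriticalCoupling`. Mathlib: `MeasurableEquiv.piCongrLeft`, `measurePreserving_piCongrLeft`,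
`MeasurePreserving.integral_comp'`, `Equiv.sum_comp`, `Equiv.swap`.
-/

noncomputable section

open MeasureTheory Finset Filter
open scoped BigOperators Topology ENNReal

namespace Literature.Probability.LatticeModels

/-! ## §1 Transport of expectations, twist currents and the twist modulus under automorphisms -/

namespace BondSystem

variable {V ι : Type*} (G : BondSystem V ι)

section Automorphism

variable [Fintype V] [Fintype ι] [MeasurableSpace Circle] [BorelSpace Circle]

/-- **Every Gibbs expectation is invariant under a coupling-preserving automorphism**: for `(e, ê)` with
`src ∘ ê = e ∘ src`, `tgt ∘ ê = e ∘ tgt`, `J ∘ ê = J` and ANY observable `f`,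
`⟨f(θ ∘ e)⟩_J = ⟨f⟩_J` — the relabelling `θ ↦ θ ∘ e` preserves the Haar product measure of `U(1)^V`
(`measurePreserving_piCongrLeft`) and the Gibbs weight (`ginibreWeight_comp_equiv`).
[cite: FriedliVelenik2017, §3.1 (symmetries of the torus; invariance of the Gibbs state); Ginibre1970, Example 4 (plane rotators)] -/
theorem expectJ_comp_automorphism {e : V ≃ V} {ehat : ι ≃ ι} (hsrc : ∀ a, G.src (ehat a) = e (G.src a))
    (htgt : ∀ a, G.tgt (ehat a) = e (G.tgt a)) {J : ι → ℝ} (hJ : ∀ a, J (ehat a) = J a)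
    (f : (V → Circle) → ℝ) :
    G.expectJ J (fun θ => f (fun v => θ (e v))) = G.expectJ J f := by
  set μ : Measure Circle := Measure.haarMeasure (⊤ : TopologicalSpace.PositiveCompacts Circle) with hμ
  have hΦ : MeasurePreserving (MeasurableEquiv.piCongrLeft (fun _ : V => Circle) e).symm (torusHaar V) (torusHaar V) :=
    (measurePreserving_piCongrLeft (fun _ : V => μ) e).symm _
  have hcoe : ∀ θ : V → Circle,
      (MeasurableEquiv.piCongrLeft (fun _ : V => Circle) e).symm θ = fun v => θ (e v) := fun θ => rfl
  have hw : ∀ θ : V → Circle, G.weightJ J (fun v => θ (e v)) = G.weightJ J θ := fun θ =>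
    G.ginibreWeight_comp_equiv hsrc htgt hJ θ
  rw [G.expectJ_eq, G.expectJ_eq]
  congr 1
  calc ∫ θ, f (fun v => θ (e v)) * G.weightJ J θ ∂torusHaar V
      = ∫ θ, (fun η : V → Circle => f η * G.weightJ J η)
          ((MeasurableEquiv.piCongrLeft (fun _ : V => Circle) e).symm θ) ∂torusHaar V := by
        refine integral_congr_ae (ae_of_all _ fun θ => ?_)
        simp only [hcoe, hw]
    _ = ∫ η, f η * G.weightJ J η ∂torusHaar V :=
        hΦ.integral_comp' (fun η : V → Circle => f η * G.weightJ J η)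

omit [Fintype V] [MeasurableSpace Circle] [BorelSpace Circle] in
/-- **The twist current under an automorphism**: `𝒥_{J,s}(θ ∘ e) = 𝒥_{J, s ∘ ê⁻¹}(θ)` (the bond character of
`a` at `θ ∘ e` is that of `ê a` at `θ`, `bondChar_comp_equiv`; reindex by `ê`).
[cite: FisherBarberJasnow1973, §II eqs. (2.4)–(2.5) (twist current); FriedliVelenik2017, §3.1 (symmetries of the torus)] -/
theorem twistCurrent_comp_automorphism {e : V ≃ V} {ehat : ι ≃ ι} (hsrc : ∀ a, G.src (ehat a) = e (G.src a))
    (htgt : ∀ a, G.tgt (ehat a) = e (G.tgt a)) {J : ι → ℝ} (hJ : ∀ a, J (ehat a) = J a) (s : ι → ℝ)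
    (θ : V → Circle) :
    G.twistCurrent J s (fun v => θ (e v)) = G.twistCurrent J (fun a => s (ehat.symm a)) θ := by
  unfold twistCurrent
  simp_rw [imChar, G.bondChar_comp_equiv hsrc htgt]
  calc ∑ a, J a * s a * (((G.bondChar (ehat a)) θ : Circle) : ℂ).im
      = ∑ a, J (ehat a) * s (ehat.symm (ehat a)) * (((G.bondChar (ehat a)) θ : Circle) : ℂ).im := by
        simp_rw [hJ, Equiv.symm_apply_apply]
    _ = ∑ b, J b * s (ehat.symm b) * (((G.bondChar b) θ : Circle) : ℂ).im :=
        Equiv.sum_comp ehat (fun b => J b * s (ehat.symm b) * (((G.bondChar b) θ : Circle) : ℂ).im)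

/-- **The twist modulus is invariant under coupling-preserving automorphisms**: `Q_J(s ∘ ê⁻¹) = Q_J(s)` — the
energy term is reindexed by `ê` with `⟨cos ∇θ_a⟩_J = ⟨cos ∇θ_{ê a}⟩_J`
(`ginibreExpect_reChar_bondChar_eq_of_automorphism`), the current fluctuation by
`⟨𝒥_{J,s}²⟩ = ⟨(𝒥_{J,s} ∘ (· ∘ e))²⟩ = ⟨𝒥_{J,s∘ê⁻¹}²⟩` (`expectJ_comp_automorphism`, `twistCurrent_comp_automorphism`),
and the mean currents vanish. [cite: FisherBarberJasnow1973, §II eqs. (2.4)–(2.5) (helicity modulus); FriedliVelenik2017, §3.1 (symmetries of the torus)] -/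
theorem twistModulus_automorphism {e : V ≃ V} {ehat : ι ≃ ι} (hsrc : ∀ a, G.src (ehat a) = e (G.src a))
    (htgt : ∀ a, G.tgt (ehat a) = e (G.tgt a)) {J : ι → ℝ} (hJ : ∀ a, J (ehat a) = J a) (s : ι → ℝ) :
    G.twistModulus J (fun a => s (ehat.symm a)) = G.twistModulus J s := by
  unfold twistModulus
  rw [G.expectJ_twistCurrent_eq_zero, G.expectJ_twistCurrent_eq_zero]
  have hE : ∀ a, G.expectJ J (reChar (G.bondChar a)) = G.expectJ J (reChar (G.bondChar (ehat a))) := fun a =>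
    G.ginibreExpect_reChar_bondChar_eq_of_automorphism hsrc htgt hJ a
  have henergy : ∑ a, J a * s (ehat.symm a) ^ 2 * G.expectJ J (reChar (G.bondChar a)) =
      ∑ a, J a * s a ^ 2 * G.expectJ J (reChar (G.bondChar a)) := by
    calc ∑ a, J a * s (ehat.symm a) ^ 2 * G.expectJ J (reChar (G.bondChar a))
        = ∑ a, J (ehat a) * s (ehat.symm (ehat a)) ^ 2 * G.expectJ J (reChar (G.bondChar (ehat a))) :=
          (Equiv.sum_comp ehat (fun b => J b * s (ehat.symm b) ^ 2 * G.expectJ J (reChar (G.bondChar b)))).symm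
      _ = ∑ a, J a * s a ^ 2 * G.expectJ J (reChar (G.bondChar a)) := by
          simp_rw [hJ, Equiv.symm_apply_apply, ← hE]
  have hfluct : G.expectJ J (fun θ => G.twistCurrent J (fun a => s (ehat.symm a)) θ ^ 2) =
      G.expectJ J (fun θ => G.twistCurrent J s θ ^ 2) := by
    rw [← G.expectJ_comp_automorphism hsrc htgt hJ (fun θ => G.twistCurrent J s θ ^ 2)]
    simp only [G.twistCurrent_comp_automorphism hsrc htgt hJ]
  rw [henergy, hfluct]

end Automorphism

end BondSystem

/-! ## §2 Permuting the lattice directions of the torus -/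

section Torus

variable {d L : ℕ}

/-- Precomposition of a site with a permutation of the directions commutes with the unit steps:
`(x + e_j) ∘ σ = x ∘ σ + e_{σ⁻¹ j}`. [cite: FriedliVelenik2017, §3.1 (lattice symmetries of the torus) — bookkeeping] -/
theorem comp_perm_add_single (σ : Equiv.Perm (Fin d)) (x : TorusSite d L) (j : Fin d) :
    (fun m => (x + Pi.single j (1 : ZMod L) : TorusSite d L) (σ m)) = (fun m => x (σ m)) + Pi.single (σ.symm j) 1 := by
  funext m
  simp only [Pi.add_apply, Pi.single_apply]
  congr 1
  by_cases h : σ m = j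
  · rw [if_pos h, if_pos (by rw [← h, Equiv.symm_apply_apply])]
  · rw [if_neg h, if_neg (fun hm => h (by rw [hm, Equiv.apply_symm_apply]))]

/-- The uniform `e_i`-twist profile read through the bond map `(x, j) ↦ (x ∘ σ⁻¹, σ j)` is the uniform
`e_{σ⁻¹ i}`-twist profile. [cite: FisherBarberJasnow1973, §II eqs. (2.3)–(2.5) (uniform twist along a lattice direction) — bookkeeping] -/
theorem axisProfile_one_perm (σ : Equiv.Perm (Fin d)) (i : Fin d) (x : TorusSite d L) (j : Fin d)
    (y : TorusSite d L) :
    axisProfile i (1 : ZMod L → ℝ) (y, σ j) = axisProfile (σ.symm i) (1 : ZMod L → ℝ) (x, j) := by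
  simp only [axisProfile, Pi.one_apply]
  by_cases h : σ j = i
  · rw [if_pos h, if_pos (by rw [← h, Equiv.symm_apply_apply])]
  · rw [if_neg h, if_neg (fun hj => h (by rw [hj, Equiv.apply_symm_apply]))]

variable [NeZero L] [MeasurableSpace Circle] [BorelSpace Circle]

/-- **Permuting the directions: `βΥ_{L,σ i}(K) = βΥ_{L,i}(K)` whenever `K ∘ σ = K`.** The site map `x ↦ x ∘ σ`
with the bond map `(x, j) ↦ (x ∘ σ, σ⁻¹ j)` is an automorphism of `torusXY d L` preserving the direction-dependent
couplings `K` (as `K(σ⁻¹ j) = K j`) and carrying the uniform `e_i`-twist to the uniform `e_{σ⁻¹ i}`-twist; the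
twist modulus is invariant (`twistModulus_automorphism`). [cite: FisherBarberJasnow1973, §II eqs. (2.4)–(2.5) (helicity modulus of a twist direction); FriedliVelenik2017, §3.1 (lattice symmetries of the torus)] -/
theorem torusXYDirStiffness_perm (σ : Equiv.Perm (Fin d)) {K : Fin d → ℝ} (hK : ∀ j, K (σ j) = K j) (i : Fin d) :
    torusXYDirStiffness L K (σ i) = torusXYDirStiffness L K i := by
  -- the automorphism
  let e : TorusSite d L ≃ TorusSite d L :=
    { toFun := fun x m => x (σ m)
      invFun := fun x m => x (σ.symm m)
      left_inv := fun x => funext fun m => by simp only [Equiv.apply_symm_apply]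
      right_inv := fun x => funext fun m => by simp only [Equiv.symm_apply_apply] }
  let ehat : TorusSite d L × Fin d ≃ TorusSite d L × Fin d := Equiv.prodCongr e σ.symm
  have hsrc : ∀ a, (torusXY d L).src (ehat a) = e ((torusXY d L).src a) := fun a => rfl
  have htgt : ∀ a, (torusXY d L).tgt (ehat a) = e ((torusXY d L).tgt a) := by
    rintro ⟨x, j⟩
    show (fun m => x (σ m)) + Pi.single (σ.symm j) (1 : ZMod L) = fun m => (x + Pi.single j (1 : ZMod L) : TorusSite d L) (σ m)
    rw [comp_perm_add_single]
  have hJ : ∀ a : TorusSite d L × Fin d, K (ehat a).2 = K a.2 := by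
    rintro ⟨x, j⟩
    show K (σ.symm j) = K j
    conv_rhs => rw [← Equiv.apply_symm_apply σ j]
    exact (hK (σ.symm j)).symm
  have hprof : (fun a => axisProfile (σ i) (1 : ZMod L → ℝ) (ehat.symm a)) = axisProfile i (1 : ZMod L → ℝ) := by
    funext a
    obtain ⟨x, j⟩ := a
    show axisProfile (σ i) (1 : ZMod L → ℝ) (e.symm x, σ.symm.symm j) = axisProfile i 1 (x, j)
    rw [Equiv.symm_symm, axisProfile_one_perm σ (σ i) x j, Equiv.symm_apply_apply]
  unfold torusXYDirStiffness
  rw [← hprof, (torusXY d L).twistModulus_automorphism hsrc htgt hJ]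

/-- **At constant coupling all directional helicity moduli of the torus coincide** (every `d`): the transposition of
two directions preserves a constant coupling vector. [cite: FisherBarberJasnow1973, §II eqs. (2.4)–(2.5); FriedliVelenik2017, §3.1 (lattice symmetries of the torus)] -/
theorem torusXYDirStiffness_const_eq (K : ℝ) (i j : Fin d) :
    torusXYDirStiffness L (fun _ : Fin d => K) i = torusXYDirStiffness L (fun _ : Fin d => K) j := by
  classical
  have h := torusXYDirStiffness_perm (L := L) (Equiv.swap i j) (K := fun _ : Fin d => K) (fun _ => rfl) i
  rw [Equiv.swap_apply_left] at h
  exact h.symm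

/-- On `(ℤ/Lℤ)²` at constant coupling the modulus along `e₂` is `torusXYStiffness L K` as well.
[cite: FisherBarberJasnow1973, §II eqs. (2.4)–(2.5) (helicity modulus)] -/
theorem torusXYDirStiffness_two_one (K : ℝ) : torusXYDirStiffness L (fun _ : Fin 2 => K) 1 = torusXYStiffness L K := by
  rw [torusXYDirStiffness_const_eq K 1 0, torusXYDirStiffness_two]

/-! ## §3 The layered rotator: the in-plane stiffness is direction-free -/

omit [NeZero L] [MeasurableSpace Circle] [BorelSpace Circle] in
/-- The layered couplings `(K∥, K∥, K⊥)` are invariant under the swap of the two in-plane directions.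
[cite: LiuStanley1972, p. 272 (layers (J, J, εJ)) — bookkeeping] -/
theorem layeredCoupling_swap (Kp Kz : ℝ) (j : Fin 3) :
    AnisotropicRotator.layeredCoupling Kp Kz (Equiv.swap (0 : Fin 3) 1 j) = AnisotropicRotator.layeredCoupling Kp Kz j := by
  fin_cases j <;> rfl

/-- **`βΥ^{3D}_{L,e₂}(K∥, K∥, K⊥) = βΥ^{3D}_{L,e₁}(K∥, K∥, K⊥)` at every `L`, `K∥`, `K⊥`**: the in-plane stack stiffness of the
layered rotator does not depend on the in-plane twist direction. [cite: FisherBarberJasnow1973, §II eqs. (2.4)–(2.5); FriedliVelenik2017, §3.1 (lattice symmetries of the torus); LiuStanley1972, p. 272] -/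
theorem torusXYDirStiffness_layered_one_eq_zero (Kp Kz : ℝ) :
    torusXYDirStiffness L (AnisotropicRotator.layeredCoupling Kp Kz) 1 =
      torusXYDirStiffness L (AnisotropicRotator.layeredCoupling Kp Kz) 0 := by
  have h := torusXYDirStiffness_perm (L := L) (Equiv.swap (0 : Fin 3) 1)
    (K := AnisotropicRotator.layeredCoupling Kp Kz) (layeredCoupling_swap Kp Kz) 0
  rwa [Equiv.swap_apply_left] at h

end Torus

namespace AnisotropicRotator

/-- **`Υ^{3D}_∞(K∥, K⊥, e₂) = Υ^{3D}_∞(K∥, K⊥, e₁)`**: the lower-envelope in-plane stack stiffness is direction-free.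
[cite: FisherBarberJasnow1973, §II eq. (2.5); FriedliVelenik2017, §3.1 (lattice symmetries of the torus)] -/
theorem layeredStiffnessLiminf_one_eq_zero (Kp Kz : ℝ) : layeredStiffnessLiminf Kp Kz 1 = layeredStiffnessLiminf Kp Kz 0 := by
  unfold layeredStiffnessLiminf
  simp only [torusXYDirStiffness_layered_one_eq_zero]

/-- **`K_Υ^{3D}(Δ, e₂) = K_Υ^{3D}(Δ, e₁)`** for every anisotropy `Δ`: the stack's in-plane stiffness transition coupling
is direction-free. [cite: FisherBarberJasnow1973, §II eq. (2.5); LiuStanley1972, p. 272 (T_c(ε) of the layers)] -/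
theorem layeredStiffnessCriticalCoupling_one_eq_zero (Δ : ℝ) :
    layeredStiffnessCriticalCoupling Δ 1 = layeredStiffnessCriticalCoupling Δ 0 := by
  unfold layeredStiffnessCriticalCoupling
  simp only [layeredStiffnessLiminf_one_eq_zero]

/-- At `K⊥ = 0` both in-plane directions reproduce the single layer: `Υ^{3D}_∞(K, 0, e₂) = Υ_∞(K)`.
[cite: FisherBarberJasnow1973, §II eq. (2.5); LiuStanley1972, p. 272 (ε = 0)] -/
theorem layeredStiffnessLiminf_zero_inPlane_one (K : ℝ) : layeredStiffnessLiminf K 0 1 = torusXYStiffnessLiminf K := by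
  rw [layeredStiffnessLiminf_one_eq_zero, layeredStiffnessLiminf_zero_inPlane]

/-- `K_Υ^{3D}(0, e₂) = K_Υ` as well. [cite: FisherBarberJasnow1973, §II eq. (2.5); LiuStanley1972, p. 272 (ε = 0)] -/
theorem layeredStiffnessCriticalCoupling_zero_inPlane_one : layeredStiffnessCriticalCoupling 0 1 = stiffnessCriticalCoupling := by
  rw [layeredStiffnessCriticalCoupling_one_eq_zero, layeredStiffnessCriticalCoupling_zero_inPlane]

end AnisotropicRotator

end Literature.Probability.LatticeModels
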